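import Literature.Computability.Complexity.MajorityVote
import Mathlib.Probability.Moments.SubGaussian
import HarnessLib

/-!
# Hoeffding's inequality over a finite uniform sample space (counting form)

Trunk T-CPLX-CORE, companion of `MajorityVote.lean` and `SamplingDeviation.lean` (Chebyshev
forms). For `m ≥ 1` independent uniform trials with outcomes in a finite nonempty `α` and an
event `good ⊆ α` of density `p = #good/|α|` (more generally a `[0,1]`-valued `F` of average `a`,
`card_upperDeviation_sum_le_exp`), the outcome sequences in which the number of good trials
(resp. `Σᵢ F(ωᵢ)`) exceeds `m p + m η` (resp. falls below `m p - m η`) number at most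
`exp(-2 m η²) · |α|^m` each (`card_upperDeviation_le_exp`, `card_lowerDeviation_le_exp`), hence
the two-sided deviation `≥ m η` has density `≤ 2 exp(-2 m η²)` (`card_deviation_le_exp`).
This exponential (Chernoff–Hoeffding) form is what direct-product decoding arguments need
(Impagliazzo–Jaiswal–Kabanets–Wigderson 2010, Lemma 2.2), where the Chebyshev form is too weak;
written for the decomposition of `Literature.Computability.Learning.cikk_natural_implies_learning`, independent of it.

Proof: Mathlib's Hoeffding inequality for sums of independent sub-Gaussian variables
(`ProbabilityTheory.HasSubgaussianMGF.measure_sum_ge_le_of_iIndepFun`) with Hoeffding's lemma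
(`hasSubgaussianMGF_of_mem_Icc`, parameter `1/4` for `[0,1]`-valued variables), the coordinates
of the product of uniform measures being independent (`iIndepFun_pi`, `uniformOn_pi`); the
statements are pure counting.

## References

* W. Hoeffding, *Probability inequalities for sums of bounded random variables*, JASA 58
  (1963), Thm. 1–2.
* R. Impagliazzo, R. Jaiswal, V. Kabanets, A. Wigderson, *Uniform direct product theorems:
  simplified, optimized, and derandomized*, SIAM J. Comput. 39 (2010), Lemma 2.2
  (Chernoff–Hoeffding) [ImpagliazzoEtAl2010].
* Mathlib: `ProbabilityTheory.HasSubgaussianMGF.measure_sum_ge_le_of_iIndepFun`,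
  `ProbabilityTheory.hasSubgaussianMGF_of_mem_Icc`, `ProbabilityTheory.iIndepFun_pi`.
-/

noncomputable section

namespace Literature.Computability.Complexity

open MeasureTheory ProbabilityTheory Finset Real

/-- **Hoeffding, upper tail, `[0,1]`-valued, counting version.** For `F : α → [0,1]` with
average `a = (Σ F)/|α|`, among the `|α|^m` outcome sequences of `m ≥ 1` independent uniform trials,
those with `Σᵢ F(ωᵢ) ≥ m a + m η` (`η ≥ 0`) number at most `exp(-2 m η²) · |α|^m`. [folklore] -/
theorem card_upperDeviation_sum_le_exp {α : Type*} [Fintype α] [Nonempty α]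
    (F : α → ℝ) (hF : ∀ a, F a ∈ Set.Icc (0 : ℝ) 1) {m : ℕ} (hm : 0 < m) {η : ℝ} (hη : 0 ≤ η) :
    ((univ.filter fun ω : Fin m → α => (m : ℝ) * η ≤
        (∑ i, F (ω i)) - m * ((∑ a, F a) / Fintype.card α)).card : ℝ) ≤
      exp (-2 * m * η ^ 2) * Fintype.card (Fin m → α) := by
  classical
  letI : MeasurableSpace α := ⊤
  haveI : MeasurableSingletonClass α := ⟨fun _ => MeasurableSpace.measurableSet_top⟩
  -- one trial: the uniform measure on `α`, the bounded variable `X = F`, its mean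
  set μ : Measure α := uniformOn (Set.univ : Set α) with hμ
  haveI : IsProbabilityMeasure μ :=
    isProbabilityMeasure_uniformOn Set.finite_univ Set.univ_nonempty
  set X : α → ℝ := F with hX
  have hXmeas : Measurable X := measurable_of_finite X
  have hXbdd : ∀ᵐ a ∂μ, X a ∈ Set.Icc (0 : ℝ) 1 := ae_of_all _ fun a => hF a
  have hXLp : MemLp X 2 μ := memLp_of_bounded hXbdd hXmeas.aestronglyMeasurable 2
  set p : ℝ := (∑ a, F a) / Fintype.card α with hp
  have hmean : μ[X] = p := by
    rw [integral_fintype (MemLp.integrable (by norm_num) hXLp)]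
    have hsing : ∀ a : α, μ.real {a} = (Fintype.card α : ℝ)⁻¹ := fun a => by
      rw [measureReal_def, hμ, uniformOn_univ, Measure.count_singleton]
      simp [ENNReal.toReal_inv]
    simp only [hsing, smul_eq_mul, ← Finset.mul_sum]
    rw [inv_mul_eq_div, hp]
  -- Hoeffding's lemma: the centred variable is sub-Gaussian with parameter `1/4`
  have hsg : HasSubgaussianMGF (fun a => X a - μ[X]) ((‖(1 : ℝ) - 0‖₊ / 2) ^ 2) μ :=
    hasSubgaussianMGF_of_mem_Icc hXmeas.aemeasurable hXbdd
  -- `m` independent trials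
  set P : Measure (Fin m → α) := Measure.pi fun _ : Fin m => μ with hP
  have hPunif : uniformOn (Set.univ : Set (Fin m → α)) = P := by
    rw [hP, ← uniformOn_pi, Set.pi_univ]
  set Y : Fin m → (Fin m → α) → ℝ := fun i ω => X (ω i) - μ[X] with hY
  have hind : iIndepFun Y P :=
    iIndepFun_pi (X := fun (_ : Fin m) (a : α) => X a - μ[X]) fun _ =>
      (hXmeas.sub_const _).aemeasurable
  have hsgi : ∀ i ∈ (univ : Finset (Fin m)),
      HasSubgaussianMGF (Y i) ((‖(1 : ℝ) - 0‖₊ / 2) ^ 2) P := by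
    intro i _
    have h := HasSubgaussianMGF.of_map (μ := P) (Y := fun ω : Fin m → α => ω i)
      (X := fun a => X a - μ[X]) (measurable_pi_apply i).aemeasurable
      (by rw [(measurePreserving_eval (fun _ : Fin m => μ) i).map_eq]; exact hsg)
    exact h
  have hhoeff := HasSubgaussianMGF.measure_sum_ge_le_of_iIndepFun hind hsgi
    (ε := (m : ℝ) * η) (by positivity)
  -- identify the sum and the event
  set B : Finset (Fin m → α) := univ.filter fun ω : Fin m → α => (m : ℝ) * η ≤
    (∑ i, F (ω i)) - m * p with hB
  have hsum : ∀ ω : Fin m → α, (∑ i : Fin m, Y i ω) = (∑ i, F (ω i)) - m * p := by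
    intro ω
    simp only [hY, Finset.sum_sub_distrib, Finset.sum_const, Finset.card_univ,
      Fintype.card_fin, nsmul_eq_mul]
    rw [hmean]
  have hBset : (B : Set (Fin m → α)) = {ω | (m : ℝ) * η ≤ ∑ i : Fin m, Y i ω} := by
    ext ω
    simp only [Finset.coe_filter, Finset.mem_univ, true_and, Set.mem_setOf_eq, hsum ω, hB]
  have hPB : P.real B ≤ exp (-2 * m * η ^ 2) := by
    rw [hBset]
    refine hhoeff.trans (le_of_eq ?_)
    congr 1
    simp only [Finset.sum_const, Finset.card_univ, Fintype.card_fin, nsmul_eq_mul]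
    have : ((‖(1 : ℝ) - 0‖₊ / 2) ^ 2 : NNReal) = (1 / 4 : ℝ) := by
      rw [sub_zero, nnnorm_one]; push_cast; norm_num
    rw [NNReal.coe_mul, this]
    have hm' : (m : ℝ) ≠ 0 := by exact_mod_cast hm.ne'
    push_cast
    field_simp
    ring
  -- read the product measure of `B` as a proportion
  have hPB' : P.real B = (B.card : ℝ) / Fintype.card (Fin m → α) := by
    rw [measureReal_def, ← hPunif, uniformOn_univ, Measure.count_apply_finset,
      ENNReal.toReal_div, ENNReal.toReal_natCast, ENNReal.toReal_natCast]
  rw [hPB'] at hPB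
  have hN : (0 : ℝ) < Fintype.card (Fin m → α) := by exact_mod_cast Fintype.card_pos
  rwa [div_le_iff₀ hN] at hPB

/-- **Hoeffding, upper tail, counting version.** Among the `|α|^m` outcome sequences of `m ≥ 1`
independent uniform trials, those with at least `m p + m η` good trials (`p` the density of
`good`, `η ≥ 0`) number at most `exp(-2 m η²) · |α|^m`. [folklore] -/
theorem card_upperDeviation_le_exp {α : Type*} [Fintype α] [Nonempty α]
    (good : α → Prop) [DecidablePred good] {m : ℕ} (hm : 0 < m) {η : ℝ} (hη : 0 ≤ η) :
    ((univ.filter fun ω : Fin m → α => (m : ℝ) * η ≤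
        ((univ.filter fun i => good (ω i)).card : ℝ) -
          m * ((univ.filter good).card / Fintype.card α)).card : ℝ) ≤
      exp (-2 * m * η ^ 2) * Fintype.card (Fin m → α) := by
  classical
  have h := card_upperDeviation_sum_le_exp (fun a => if good a then (1 : ℝ) else 0)
    (fun a => by split_ifs <;> simp) hm hη
  refine le_trans (le_of_eq ?_) h
  congr 2
  ext ω
  simp only [mem_filter, mem_univ, true_and, Finset.natCast_card_filter]

/-- **Hoeffding, lower tail, counting version.** Those with at most `m p - m η` good trials
number at most `exp(-2 m η²) · |α|^m`. [folklore] -/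
theorem card_lowerDeviation_le_exp {α : Type*} [Fintype α] [Nonempty α]
    (good : α → Prop) [DecidablePred good] {m : ℕ} (hm : 0 < m) {η : ℝ} (hη : 0 ≤ η) :
    ((univ.filter fun ω : Fin m → α => (m : ℝ) * η ≤
        m * ((univ.filter good).card / Fintype.card α) -
          ((univ.filter fun i => good (ω i)).card : ℝ)).card : ℝ) ≤
      exp (-2 * m * η ^ 2) * Fintype.card (Fin m → α) := by
  classical
  -- apply the upper tail to the complementary event
  have h := card_upperDeviation_le_exp (fun a => ¬ good a) hm hη
  have hcompl : ((univ.filter fun a : α => ¬ good a).card : ℝ) =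
      Fintype.card α - (univ.filter good).card := by
    have := Finset.card_filter_add_card_filter_not (s := (univ : Finset α)) good
    rw [card_univ] at this
    rw [eq_sub_iff_add_eq, add_comm]; exact_mod_cast this
  have hcompl' : ∀ ω : Fin m → α, ((univ.filter fun i => ¬ good (ω i)).card : ℝ) =
      m - (univ.filter fun i => good (ω i)).card := by
    intro ω
    have := Finset.card_filter_add_card_filter_not (s := (univ : Finset (Fin m)))
      (fun i => good (ω i))
    rw [card_univ, Fintype.card_fin] at this
    rw [eq_sub_iff_add_eq, add_comm]; exact_mod_cast this
  have hα : (0 : ℝ) < Fintype.card α := by exact_mod_cast Fintype.card_pos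
  refine le_trans (le_of_eq ?_) h
  congr 2
  ext ω
  simp only [mem_filter, mem_univ, true_and, hcompl, hcompl' ω]
  rw [sub_div, div_self hα.ne']
  constructor <;> intro hω <;> linarith

/-- **Hoeffding, two-sided, counting version** (Chernoff–Hoeffding as quoted by
Impagliazzo–Jaiswal–Kabanets–Wigderson, Lemma 2.2, additive form): the outcome sequences whose
number of good trials deviates from `m p` by at least `m η` (`η > 0`) number at most
`2 exp(-2 m η²) · |α|^m`. [folklore] -/
theorem card_deviation_le_exp {α : Type*} [Fintype α] [Nonempty α]
    (good : α → Prop) [DecidablePred good] {m : ℕ} (hm : 0 < m) {η : ℝ} (hη : 0 ≤ η) :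
    ((univ.filter fun ω : Fin m → α => (m : ℝ) * η ≤
        |((univ.filter fun i => good (ω i)).card : ℝ) -
          m * ((univ.filter good).card / Fintype.card α)|).card : ℝ) ≤
      2 * exp (-2 * m * η ^ 2) * Fintype.card (Fin m → α) := by
  classical
  have h1 := card_upperDeviation_le_exp good hm hη
  have h2 := card_lowerDeviation_le_exp good hm hη
  have hsub : (univ.filter fun ω : Fin m → α => (m : ℝ) * η ≤
      |((univ.filter fun i => good (ω i)).card : ℝ) -
        m * ((univ.filter good).card / Fintype.card α)|) ⊆
      (univ.filter fun ω : Fin m → α => (m : ℝ) * η ≤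
        ((univ.filter fun i => good (ω i)).card : ℝ) -
          m * ((univ.filter good).card / Fintype.card α)) ∪
      (univ.filter fun ω : Fin m → α => (m : ℝ) * η ≤
        m * ((univ.filter good).card / Fintype.card α) -
          ((univ.filter fun i => good (ω i)).card : ℝ)) := by
    intro ω hω
    rw [mem_union, mem_filter, mem_filter]
    have h := (mem_filter.1 hω).2
    rcases le_abs'.1 h with h' | h'
    · exact Or.inr ⟨mem_univ _, by linarith⟩
    · exact Or.inl ⟨mem_univ _, h'⟩
  calc _ ≤ (((univ.filter fun ω : Fin m → α => (m : ℝ) * η ≤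
        ((univ.filter fun i => good (ω i)).card : ℝ) -
          m * ((univ.filter good).card / Fintype.card α)) ∪
      (univ.filter fun ω : Fin m → α => (m : ℝ) * η ≤
        m * ((univ.filter good).card / Fintype.card α) -
          ((univ.filter fun i => good (ω i)).card : ℝ))).card : ℝ) := by
        exact_mod_cast card_le_card hsub
    _ ≤ _ := by
        refine (Nat.cast_le.2 (card_union_le _ _)).trans ?_
        push_cast
        linarith

end Literature.Computability.Complexity
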